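import Summits.CriticalPhenomena.PercolationContinuityZ3.Theorems.PercNearOneGluingNoHeavyLowerTailFKCSHPhiMonotone
import HarnessLib

/-!
# FK sub-lane: the route crux `NoHeavyLowerTail` for the random-cluster measures `φ_{w,q}`, every `q ≥ 1`

Support file (`--supports stmt-CriticalPhenomena-4575`), FK sub-lane `prim-bschramm-fk-2` (gen 5) of the post-continuity programme;
builds on p205010 (kernel theorem, internal audit signed; external expert review pending).  No definitions, no named facts, no sorries;
standard axioms.

`FK.NoHeavyLowerTailFK q` (fk-1's `…FKAnalogues.lean`: the crux `PercNearOneGluingNoHeavy.NoHeavyLowerTail` of this route — item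
stmt-CriticalPhenomena-4575 — with `φ_{w,q} = rcMeasureW w q ∅` for `prodBernoulli w`) was the one statement of the FK dictionary left
undecided for `q ≠ 1` after the finite leg closed (`FK.additiveGluingFK_of_one_le`, `FK.nearOneGluingFK_of_one_le`, fk-1 g3 / fk-2 g4).
It follows from near-one gluing by a MEASURE-GENERIC Markov-inequality argument (no correlation inequality is needed):

* `FK.lowerTail_real_le` — for ANY probability measure `μ` on bond configurations: if every relay is met by the observer with probability
  `> 1 − η` (`η ≥ 0`), then `μ(1 ≤ N < δ·E N/ε) ≤ 2η` whenever `δ ≤ ε/2` (`N = |C(o) ∩ A|`, `E N = Σ_a μ(o ↔ a) ≤ |A|`; on the event, `|A| − N > |A|/2`,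
  and `E(|A| − N) < η|A|`);
* `FK.noHeavyLowerTailFK_of_nearOneGluingFK` (`0 < q`): near-one gluing at `b := a' ∈ A` makes every relay `(1 − ε/4)`-met;
* `FK.noHeavyLowerTailFK_of_additiveGluingFK` (`0 < q`), **`FK.noHeavyLowerTailFK_of_one_le : 1 ≤ q → NoHeavyLowerTailFK q`**,
  `FK.noHeavyLowerTailFK_two` — the crux of route `PercNearOneGluingNoHeavy` holds for every random-cluster measure with `q ≥ 1`.
[cite: KozmaNitzan2024, Conj. 1 (p. 3), Conj. 3 (p. 15)] [cite: Grimmett2006, §1.4 eq. (1.20) (p. 15)]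
-/

noncomputable section

namespace Summit.CriticalPhenomena.PercolationContinuityZ3.Theorems

open MeasureTheory Set Literature.Probability.LatticeModels Literature.Probability.Percolation
open scoped Classical

namespace FK

variable {n : ℕ}

/-- **The lower tail of the number of met relays, under ANY probability measure.**  If each relay `a ∈ A` is met by the observer `o`
with probability `> 1 − η` and `δ ≤ ε/2`, then `μ(1 ≤ N ∧ N < δ·(Σ_a μ(o ↔ a))/ε) ≤ 2η`, `N(ω) = |{a ∈ A : o ↔ a}|`.
Markov's inequality for `|A| − N ≥ 0`: on the event `N < |A|/2`, while `E(|A| − N) = |A| − Σ_a μ(o ↔ a) < η|A|`. [folklore] -/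
theorem lowerTail_real_le (μ : Measure (BondConfig (Fin n))) [IsProbabilityMeasure μ] (A : Finset (Fin n)) (o : Fin n)
    {ε δ η : ℝ} (hε : 0 < ε) (hδ : δ ≤ ε / 2) (hη : 0 ≤ η) (hrel : ∀ a ∈ A, 1 - η < μ.real (openConn o a)) :
    μ.real {ω : BondConfig (Fin n) | 1 ≤ (A.filter fun a => ω ∈ openConn o a).card ∧
        ((A.filter fun a => ω ∈ openConn o a).card : ℝ) < δ * (∑ a ∈ A, μ.real (openConn o a)) / ε} ≤ 2 * η := by
  classical
  have hmeas : ∀ S : Set (BondConfig (Fin n)), MeasurableSet S := fun _ => MeasurableSet.of_discrete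
  have hint : ∀ (g : BondConfig (Fin n) → ℝ), Integrable g μ := fun g => Integrable.of_finite
  set N : BondConfig (Fin n) → ℝ := fun ω => ((A.filter fun a => ω ∈ openConn o a).card : ℝ) with hN
  set EN : ℝ := ∑ a ∈ A, μ.real (openConn o a) with hEN
  set m : ℝ := (A.card : ℝ) with hm
  set E : Set (BondConfig (Fin n)) := {ω : BondConfig (Fin n) | 1 ≤ (A.filter fun a => ω ∈ openConn o a).card ∧
      ((A.filter fun a => ω ∈ openConn o a).card : ℝ) < δ * EN / ε} with hE
  -- trivial case `A = ∅`: the event is empty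
  rcases A.eq_empty_or_nonempty with hA0 | hAne
  · have hEempty : E = ∅ := by
      ext ω
      simp only [hE, hA0, Finset.filter_empty, Finset.card_empty, mem_setOf_eq, mem_empty_iff_false, iff_false, not_and]
      intro h; exact absurd h (by norm_num)
    show μ.real E ≤ 2 * η
    rw [hEempty, measureReal_empty]
    linarith
  -- `A ≠ ∅`
  have hmpos : 0 < m := by rw [hm]; exact_mod_cast Finset.card_pos.2 hAne
  have hENle : EN ≤ m := by
    rw [hEN, hm]
    calc ∑ a ∈ A, μ.real (openConn o a) ≤ ∑ _a ∈ A, (1 : ℝ) := Finset.sum_le_sum fun a _ => measureReal_le_one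
      _ = (A.card : ℝ) := by simp
  have hENgt : m * (1 - η) < EN := by
    rw [hEN, hm]
    calc (A.card : ℝ) * (1 - η) = ∑ _a ∈ A, (1 - η) := by rw [Finset.sum_const, nsmul_eq_mul]
      _ < ∑ a ∈ A, μ.real (openConn o a) := Finset.sum_lt_sum_of_nonempty hAne fun a ha => hrel a ha
  -- `E[N] = EN`
  have hNsum : ∀ ω, N ω = ∑ a ∈ A, (openConn o a : Set (BondConfig (Fin n))).indicator (1 : BondConfig (Fin n) → ℝ) ω := by
    intro ω
    rw [hN]
    simp only [indicator_apply, Pi.one_apply, Finset.sum_boole]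
  have hintN : ∫ ω, N ω ∂μ = EN := by
    simp_rw [hNsum]
    rw [integral_finsetSum _ fun a _ => hint _]
    exact Finset.sum_congr rfl fun a _ => integral_indicator_one (hmeas _)
  -- on `E`: `m/2 ≤ m − N`
  have hptE : ∀ ω ∈ E, m / 2 ≤ m - N ω := by
    intro ω hω
    have h2 : N ω < δ * EN / ε := hω.2
    have hEN0 : 0 ≤ EN := Finset.sum_nonneg fun a _ => measureReal_nonneg
    have h3 : δ * EN / ε ≤ EN / 2 := by
      rw [div_le_iff₀ hε]
      nlinarith [hδ, hEN0]
    linarith [hENle]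
  -- `N ≤ m` everywhere
  have hNle : ∀ ω, N ω ≤ m := by
    intro ω
    show ((A.filter fun a => ω ∈ openConn o a).card : ℝ) ≤ (A.card : ℝ)
    exact_mod_cast Finset.card_filter_le _ _
  -- Markov: `(m/2) μ(E) ≤ ∫ (m − N) = m − EN < m η`
  have h1 : ∫ _ω in E, (m / 2 : ℝ) ∂μ = (m / 2) * μ.real E := by
    rw [setIntegral_const, smul_eq_mul, mul_comm]
  have h2 : ∫ _ω in E, (m / 2 : ℝ) ∂μ ≤ ∫ ω in E, (m - N ω) ∂μ :=
    setIntegral_mono_on (hint _).integrableOn (hint _).integrableOn (hmeas E) fun ω hω => hptE ω hω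
  have h3 : ∫ ω in E, (m - N ω) ∂μ ≤ ∫ ω, (m - N ω) ∂μ :=
    setIntegral_le_integral (hint _) (Filter.Eventually.of_forall fun ω => by
      simp only [Pi.zero_apply]; linarith [hNle ω])
  have h4 : ∫ ω, (m - N ω) ∂μ = m - EN := by
    rw [integral_sub (hint _) (hint _), integral_const, smul_eq_mul, hintN]
    simp
  have h5 : (m / 2) * μ.real E ≤ m - EN := by linarith [h1, h2, h3, h4]
  have h6 : m - EN < m * η := by linarith [hENgt]
  have h7 : m * μ.real E < m * (2 * η) := by nlinarith [h5, h6, hmpos]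
  exact (lt_of_mul_lt_mul_left h7 hmpos.le).le

/-- **FK near-one gluing ⟹ FK no heavy lower tail**, for every `q > 0` (so that `φ_{w,q}` is a probability measure): take `δ₁` from
`NearOneGluingFK q` at `ε/4` and `δ := min δ₁ (ε/2)`; near-one gluing with `b := a' ∈ A` makes every relay `(1 − ε/4)`-met by `o`, and
`FK.lowerTail_real_le` bounds the event by `ε/2 < ε`. [cite: KozmaNitzan2024, Conj. 3 (p. 15)] [cite: Grimmett2006, §1.4 eq. (1.20) (p. 15)] -/
theorem noHeavyLowerTailFK_of_nearOneGluingFK {q : ℝ} (hq : 0 < q) (hX : NearOneGluingFK q) : NoHeavyLowerTailFK q := by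
  intro ε hε
  obtain ⟨δ₁, hδ₁, hNOG⟩ := hX (ε / 4) (by positivity)
  refine ⟨min δ₁ (ε / 2), lt_min hδ₁ (by positivity), ?_⟩
  intro n w A o hoA hrel
  haveI := isProbabilityMeasure_rcMeasureW w hq (∅ : Set (Fin n))
  have hoA' : 1 - δ₁ < (rcMeasureW w q ∅).real (⋃ a ∈ A, openConn o a) := lt_of_le_of_lt (by linarith [min_le_left δ₁ (ε / 2)]) hoA
  have hmet : ∀ a' ∈ A, 1 - ε / 4 < (rcMeasureW w q ∅).real (openConn o a') := by
    intro a' ha'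
    refine hNOG n w A o a' hoA' fun a ha => lt_of_le_of_lt (by linarith [min_le_left δ₁ (ε / 2)]) (hrel a ha a' ha')
  have key := lowerTail_real_le (rcMeasureW w q ∅) A o hε (min_le_right δ₁ (ε / 2)) (by positivity) hmet
  linarith

/-- **FK additive gluing ⟹ FK no heavy lower tail**, for every `q > 0` (via `FK.nearOneGluingFK_of_additiveGluingFK`).
[cite: KozmaNitzan2024, Conj. 1 ⇒ Conj. 3 (p. 15)] -/
theorem noHeavyLowerTailFK_of_additiveGluingFK {q : ℝ} (hq : 0 < q) (hAG : AdditiveGluingFK q) : NoHeavyLowerTailFK q :=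
  noHeavyLowerTailFK_of_nearOneGluingFK hq (nearOneGluingFK_of_additiveGluingFK q hAG)

/-- **THE ROUTE CRUX `NoHeavyLowerTail` FOR EVERY RANDOM-CLUSTER MEASURE `φ_{w,q}`, `q ≥ 1`** (every finite weighted graph, every relay
set): `FK.NoHeavyLowerTailFK q`, from the tree theorem `FK.nearOneGluingFK_of_one_le` (Kozma–Nitzan's Conjecture 3 for `φ_{w,q}`, fk-1 g3 ∘ fk-2 g4)
and the measure-generic lower-tail bound.  At `q = 1` this is the crux `CSH.noHeavyLowerTail_holds` (item stmt-CriticalPhenomena-4575) again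
(`noHeavyLowerTailFK_one_iff`); builds on p205010 (kernel theorem, internal audit signed; external expert review pending).
[cite: KozmaNitzan2024, Conj. 1 (p. 3), Conj. 3 (p. 15)] [cite: Grimmett2006, §1.4 eq. (1.20) (p. 15)] -/
theorem noHeavyLowerTailFK_of_one_le {q : ℝ} (hq : 1 ≤ q) : NoHeavyLowerTailFK q :=
  noHeavyLowerTailFK_of_nearOneGluingFK (by linarith) (nearOneGluingFK_of_one_le hq)

/-- In particular the FK–Ising case `q = 2` (the `q = 2` route of FK sub-lane 2). [cite: KozmaNitzan2024, Conj. 1 (p. 3)] -/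
theorem noHeavyLowerTailFK_two : NoHeavyLowerTailFK 2 := noHeavyLowerTailFK_of_one_le (by norm_num)

end FK

end Summit.CriticalPhenomena.PercolationContinuityZ3.Theorems

end
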